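import Summits.AtomisticToContinuum.FouriersLaw.Theses.KineticCorner
import Summits.AtomisticToContinuum.FouriersLaw.Theorems.EmbeddedDrudeMourreMourreDissolutionOfKineticCorner
import HarnessLib

/-!
# `GoodFamilyExists` — good triples exist at every temperature (stmt-AtomisticToContinuum-3434)

Item `stmt-AtomisticToContinuum-3434` (support `GoodFamilyExists` of route `KineticCorner`, sub-problem
`FouriersLaw`): for `pinnedChain ω₂ lam β γ` (all `> 0`) and every `T > 0` there are `μ`, `D` forming a GOOD
triple `(T, μ, D)` — `μ` a DLR Gibbs state at `T`, `D` an infinite-volume dynamics preserving `μ`, absolutely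
convergent summed current correlations at every time, `t ↦ C_T(t)` locally integrable on `[0, S]`, `μ`
invariant under the unit lattice shift, and the flow shift-covariant (pointwise, everywhere).

Proof: the canonical symmetric Buttà–Marchioro datum of
`Theorems.MourreDissolution.canonicalDatum` (carrier `bmGood`, identity off `bmGood`, hence commuting with the
translations EVERYWHERE; at every `T > 0` a zero-wavenumber datum `Z` with DLR state `Z.μ` and strongly
continuous Koopman group, built on the landed Gibbs/clustering statement `stub_gibbsClustering`) is a good triple
by `Theorems.MourreDissolution.goodTriple_of_canonicalDatum` (`C_T` is continuous, hence locally integrable).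
Both inputs landed with p121356 (lead c2 of stmt-12594). This file is also the closing of stub G of line
`Sketch` (rev 7) of the crux `DrudeDissolution` (stmt-12593), whose composition feeds `GoodFamilyExists` into
`TargetGlue`.
-/

noncomputable section

namespace Summit.AtomisticToContinuum.FouriersLaw.Theorems.KineticCorner

open Literature.MathematicalPhysics.KineticTheory.HeatConduction

/-- **Good triples exist** (`Theses.KineticCorner.GoodFamilyExists`, stmt-AtomisticToContinuum-3434): for
`pinnedChain ω₂ lam β γ` (all `> 0`; `γ` idle) and every `T > 0`, the canonical symmetric Buttà–Marchioro
dynamics with the zero-wavenumber datum's DLR state at `T` is a good triple — DLR, measure-preserving,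
absolutely convergent and locally integrable summed current correlations, shift-invariant state,
shift-covariant flow. [folklore] -/
theorem goodFamilyExists_proof :
    Summit.AtomisticToContinuum.FouriersLaw.Theses.KineticCorner.GoodFamilyExists := by
  intro ω₂ lam β γ hω hl hβ _ T hT
  obtain ⟨D, -, hsh, hZ⟩ := MourreDissolution.canonicalDatum ω₂ lam β γ hω hl hβ
  obtain ⟨Z, hG, -, -, hsc⟩ := hZ T hT
  exact ⟨Z.μ, D, MourreDissolution.goodTriple_of_canonicalDatum hsh Z hG hsc⟩

end Summit.AtomisticToContinuum.FouriersLaw.Theorems.KineticCorner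

end
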